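import Summits.BirchSwinnertonDyer.BirchSwinnertonDyer.Theorems.SylvesterTwoHeegnerIndexThmCAssembly
import HarnessLib

/-!
# Route `SylvesterTwoHeegnerIndex` (rung K7t), item 19580 `TwoAdicPairHSY`: the typed THEOREM C
# (`HSYPointTwoDivisibleSevenModNine`) FROM the `2`-integrality of the pair product — the converse
# of x1b's `pairProductTwoIntegral_of_heightDisplay_of_thmC`, hence the kernel EQUIVALENCE of the two
# typed forms of THEOREM C modulo Hu–Shu–Yin's printed display

Cell `bsd-cm`, seat `bsd-cm-two` (prover-bsd-cm-two-g7-0). PARTITION (D55): CornerF at `p = 2`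
(B14/O12) × 𝒞_HSY ∩ {p ≡ 7 (mod 9)} × `p = 2` — types-the-object-of (kernel helper
`--supports stmt-BirchSwinnertonDyer-19580`); closes no cell and no item; BSD is not claimed.
Everything here is PROVED: no definition, no named fact, no `sorry`. The only published input is the
display `HuShuYin2019.shaAnPair_mul_height_eq_two_zpow_mul_height` (x1b GEN 48, p443765), taken as a
HYPOTHESIS where it is used (§3), exactly as in x1b's assembly `…ThmCAssembly` (p456911).

* §1 (`θ`-currency, any field `F ∋ ω`, Mordell equation, `θ = [ω]`, `P` NOT of the form `2·Z + T`):
  `two_dvd_of_not_two_dvd_of_two_le_padicValRat` (arithmetic: `n` odd and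
  `2 ≤ ord₂((a² − ab + b²)/n²)` force `2 ∣ a`, `2 ∣ b` — `2` is inert in `ℤ[ω]`, x1b's
  `norm_odd_of_not_two_dvd`) and the **`2`-DIVISIBILITY DESCENT**
  `exists_eq_two_smul_add_torsion_of_two_le_padicValRat`: if `n·Y = a·P + b·θP + T` (`n ≠ 0`,
  `T` torsion) and `2 ≤ ord₂((a² − ab + b²)/n²)` then `Y ∈ 2·W(F) + tors` (strong induction on `|n|`
  with this seat's mod-`2` unit trick `exists_eq_two_smul_add_torsion`, p442958). This is the converse
  of the `2`-primitive descent `padicValRat_two_norm_div_sq_nonneg` sharpened by two: the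
  `ℤ₂[ω]`-coordinate of `Y` along `P` lies in `2ℤ₂[ω]` iff `Y` is `2`-divisible modulo torsion.
* §2 (engine currency of `…TwoAdicPairModelNonneg`: a model `B/ℚ` of `E_p`, `K ∋ ω` quadratic,
  `rank_ℤ B(K) = 2`, rational generator `P₀` in `ι`-form, `Y ∈ B(K)`, `q ≠ 0` with
  `q·ĥ_K(ι P₀) = 2^i·ĥ_K(Y)`): **`exists_eq_two_smul_add_torsion_of_model_of_le_padicValRat`** —
  `i + 2 ≤ ord₂ q ⇒ Y ∈ 2·B(K) + tors`, the converse of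
  `add_two_le_padicValRat_two_of_model_of_twoDivisible` (p444380); together
  `twoDivisible_iff_add_two_le_padicValRat_of_model`.
* §3 (display level): **`hsyPointTwoDivisibleSevenModNine_of_heightDisplay_of_twoIntegral`** —
  `[display] → PairProductTwoIntegralSevenModNine → HSYPointTwoDivisibleSevenModNine`, and with x1b's
  converse **`hsyPointTwoDivisibleSevenModNine_iff_pairProductTwoIntegral_of_heightDisplay`**:
  modulo the PRINTED display the crux-to-be `HSYPointTwoDivisibleSevenModNine` (memo THEOREM C as
  typed) and `PairProductTwoIntegralSevenModNine` (`0 ≤ ord₂(#Ш_an(E_p)·#Ш_an(E_{3p²}))` on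
  `p ≡ 7 (9)`) are ONE statement. HONEST READING: the typed THEOREM C is therefore an L-VALUE
  `2`-integrality statement in lattice clothing; its only proof on file is memo §15.5 (C-a)–(C-d)
  (Shimura reciprocity for HSY's own CM point), which is cell content, not print, not kernel.

## References
* Y. Hu, J. Shu, H. Yin, Trans. AMS 372 (2019) = arXiv:1708.05266, p. 12 display (bsd), p. 8.
* MEMO bsd-cm-two v2.7 §15.5 (THEOREM C), §38; v2.8 §39 (this equivalence).
* J. H. Silverman, *The Arithmetic of Elliptic Curves*, GTM 106, VIII.9 (heights), X.1 (descent).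
-/

set_option autoImplicit false
-- the Summit-side namespace `Summit.BirchSwinnertonDyer.BirchSwinnertonDyer.…` (summit = problem) is mandated by D-0017
set_option linter.dupNamespace false

noncomputable section

open scoped Classical

open WeierstrassCurve WeierstrassCurve.Affine WeierstrassCurve.Affine.Point
  Summit.BirchSwinnertonDyer.BirchSwinnertonDyer.Theorems.SylvesterTwoCMNormForm
  Summit.BirchSwinnertonDyer.BirchSwinnertonDyer.Theorems.SylvesterTwoThmCAssembly
  Literature.NumberTheory.EllipticCurves Literature.NumberTheory.EllipticCurves.HuShuYin2019

namespace Summit.BirchSwinnertonDyer.BirchSwinnertonDyer.Theorems.SylvesterTwoNonneg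

/-! ## §1 `θ`-currency: `2`-divisibility from `2 ≤ ord₂` of the coordinate's norm -/

section Theta

variable {F : Type*} [Field F] {W : WeierstrassCurve F} {ω : F}
variable (hω : ω ^ 2 + ω + 1 = 0) (h1 : W.a₁ = 0) (h2 : W.a₂ = 0) (h3 : W.a₃ = 0) (h4 : W.a₄ = 0)
variable {θ : W.toAffine.Point → W.toAffine.Point} (hθ0 : θ 0 = 0)
  (hθ : ∀ (x y : F) (h : W.toAffine.Nonsingular x y),
    θ (.some x y h) = .some (ω * x) y (nonsingular_omega_mul hω h1 h2 h3 h4 h))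

/-- **Arithmetic of the inert prime `2`.** If `n` is odd and `2 ≤ ord₂((a² − ab + b²)/n²)` then
`2 ∣ a` and `2 ∣ b`: otherwise `a² − ab + b²` is odd (`norm_odd_of_not_two_dvd`, the residue field of
`ℤ[ω]` at `2` is `𝔽₄`) and the valuation is `0`. [folklore] -/
theorem two_dvd_of_not_two_dvd_of_two_le_padicValRat {a b n : ℤ} (hn : ¬ (2 : ℤ) ∣ n)
    (hv : 2 ≤ padicValRat 2 (((a ^ 2 - a * b + b ^ 2 : ℤ) : ℚ) / ((n : ℚ) ^ 2))) :
    (2 : ℤ) ∣ a ∧ (2 : ℤ) ∣ b := by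
  by_contra hab
  have hodd : ¬ (2 : ℤ) ∣ a ^ 2 - a * b + b ^ 2 := norm_odd_of_not_two_dvd hab
  have hn0 : n ≠ 0 := fun h => hn (h ▸ dvd_zero 2)
  have hN0 : (a ^ 2 - a * b + b ^ 2 : ℤ) ≠ 0 := fun h => hodd (h ▸ dvd_zero 2)
  have hvn : padicValRat 2 (n : ℚ) = 0 := by
    rw [padicValRat.of_int, padicValInt.eq_zero_of_not_dvd hn]; rfl
  have hvN : padicValRat 2 ((a ^ 2 - a * b + b ^ 2 : ℤ) : ℚ) = 0 := by
    rw [padicValRat.of_int, padicValInt.eq_zero_of_not_dvd hodd]; rfl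
  rw [padicValRat.div (by exact_mod_cast hN0) (pow_ne_zero 2 (by exact_mod_cast hn0)),
    padicValRat.pow, hvn, hvN] at hv
  norm_num at hv

include hω h1 h2 h3 h4 hθ0 hθ

/-- **`2`-DIVISIBILITY DESCENT (converse of the `2`-primitive descent, sharpened by two).** On a
Mordell equation over a field with `ω` (`ω² + ω + 1 = 0`, `ω ≠ 1`), let `P` be NOT of the form
`2·Z + T` with `T` torsion. If `n·Y = a·P + b·θP + T` with `n ≠ 0`, `T` torsion — i.e.
`Y = ((a + bω)/n) ⊗ P` — and `2 ≤ ord₂((a² − ab + b²)/n²)` (the coordinate lies in `2ℤ₂[ω]`),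
then **`Y ∈ 2·W(F) + tors`**. Strong induction on `|n|`: for `n` even the mod-`2` unit trick
(`exists_eq_two_smul_add_torsion`) forces `a, b` even and one halves (same rational number); for
`n` odd, `2 ∣ a, b` by `two_dvd_of_not_two_dvd_of_two_le_padicValRat` and
`Y = n·Y − (n − 1)·Y = 2·(a′·P + b′·θP − ((n − 1)/2)·Y) + T`.
[cite: HuShuYin2019, p. 8 (`K ⊗_{𝒪_K} E_p(K) ≃ K`)] -/
theorem exists_eq_two_smul_add_torsion_of_two_le_padicValRat (hω1 : ω ≠ 1) {P : W.toAffine.Point}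
    (hP : ∀ Z T : W.toAffine.Point, IsOfFinAddOrder T → P ≠ (2 : ℤ) • Z + T) :
    ∀ (k : ℕ) {Y T : W.toAffine.Point} {n a b : ℤ}, n.natAbs ≤ k → n ≠ 0 → IsOfFinAddOrder T →
      n • Y = a • P + b • θ P + T →
      2 ≤ padicValRat 2 (((a ^ 2 - a * b + b ^ 2 : ℤ) : ℚ) / ((n : ℚ) ^ 2)) →
      ∃ Y' T' : W.toAffine.Point, IsOfFinAddOrder T' ∧ Y = (2 : ℤ) • Y' + T' := by
  intro k
  induction k with
  | zero =>
    intro Y T n a b hk hn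
    exact absurd (Int.natAbs_eq_zero.mp (Nat.le_zero.mp hk)) hn
  | succ k ih =>
    intro Y T n a b hk hn hT hY hv
    by_cases h2n : (2 : ℤ) ∣ n
    · obtain ⟨n', rfl⟩ := h2n
      have hn' : n' ≠ 0 := by rintro rfl; exact hn (by ring)
      -- `a·P + b·θP = 2·(n'·Y) + (−T)`: the unit trick forces `a, b` even
      have hrel : a • P + b • θ P = (2 : ℤ) • (n' • Y) + (-T) := by
        rw [← mul_smul, hY]; abel
      have hab : (2 : ℤ) ∣ a ∧ (2 : ℤ) ∣ b := by
        by_contra hab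
        obtain ⟨Z', T', hT', hP'⟩ :=
          exists_eq_two_smul_add_torsion hω h1 h2 h3 h4 hθ0 hθ hω1 hT.neg hrel hab
        exact hP Z' T' hT' hP'
      obtain ⟨⟨a', rfl⟩, ⟨b', rfl⟩⟩ := hab
      -- halve: `2·(n'·Y − a'·P − b'·θP) = T` is torsion, hence so is `n'·Y − a'·P − b'·θP`
      have htwice : (2 : ℤ) • (n' • Y - a' • P - b' • θ P) = T := by
        calc (2 : ℤ) • (n' • Y - a' • P - b' • θ P)
            = (2 * n') • Y - (2 * a') • P - (2 * b') • θ P := by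
              rw [smul_sub, smul_sub, ← mul_smul, ← mul_smul, ← mul_smul]
          _ = T := by rw [hY]; abel
      have hT' : IsOfFinAddOrder (n' • Y - a' • P - b' • θ P) :=
        isOfFinAddOrder_of_zsmul two_ne_zero (htwice ▸ hT)
      have hY' : n' • Y = a' • P + b' • θ P + (n' • Y - a' • P - b' • θ P) := by abel
      have hk' : n'.natAbs ≤ k := by
        have : (2 * n').natAbs = 2 * n'.natAbs := by rw [Int.natAbs_mul]; rfl
        have hpos : 0 < n'.natAbs := Int.natAbs_pos.mpr hn'
        omega
      -- same rational number
      have e : (((2 * a') ^ 2 - 2 * a' * (2 * b') + (2 * b') ^ 2 : ℤ) : ℚ) / (((2 * n' : ℤ) : ℚ) ^ 2)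
          = ((a' ^ 2 - a' * b' + b' ^ 2 : ℤ) : ℚ) / ((n' : ℚ) ^ 2) := by
        have hn'Q : (n' : ℚ) ≠ 0 := by exact_mod_cast hn'
        push_cast
        field_simp
      rw [e] at hv
      exact ih hk' hn' hT' hY' hv
    · -- `n` odd: `2 ∣ a`, `2 ∣ b`, and `Y = n·Y − (n−1)·Y`
      obtain ⟨⟨a', rfl⟩, ⟨b', rfl⟩⟩ := two_dvd_of_not_two_dvd_of_two_le_padicValRat h2n hv
      obtain ⟨m, hm⟩ : ∃ m : ℤ, n = 2 * m + 1 := by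
        rcases Int.emod_two_eq_zero_or_one n with h0 | h0
        · exact absurd (Int.dvd_of_emod_eq_zero h0) h2n
        · exact ⟨n / 2, by omega⟩
      subst hm
      refine ⟨a' • P + b' • θ P - m • Y, T, hT, ?_⟩
      have e : (2 * m + 1) • Y = (2 : ℤ) • (m • Y) + Y := by
        rw [add_smul, one_smul, mul_smul]
      rw [e] at hY
      calc Y = ((2 * a') • P + (2 * b') • θ P + T) - (2 : ℤ) • (m • Y) := (eq_sub_of_add_eq' hY)
        _ = (2 : ℤ) • (a' • P + b' • θ P - m • Y) + T := by
          rw [mul_smul, mul_smul, smul_sub, smul_add]; abel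

end Theta

/-! ## §2 Engine currency: `i + 2 ≤ ord₂ q ⇒ Y ∈ 2·B(K) + tors` on a model of `E_p` -/

section Model

variable {K : Type} [Field K] [NumberField K] {ω : K}

/-- **MODEL-LEVEL `2`-DIVISIBILITY FROM THE VALUATION (converse of
`add_two_le_padicValRat_two_of_model_of_twoDivisible`).** `K/ℚ` quadratic with `ω ∈ K`
(`ω² + ω + 1 = 0`), `B/ℚ` a model of `E_p` (`C • B = cubeSumCurve p`, `p` an odd prime) with
`rank_ℤ B(K) = 2`, `P₀ ∈ B(ℚ)` a generator modulo torsion in `ι`-form with `ι P₀` of infinite order,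
`Y ∈ B(K)`, `q ≠ 0` rational with `q·ĥ_K(ι P₀) = 2^i·ĥ_K(Y)`. If `i + 2 ≤ ord₂ q` then
`Y = 2·Y′ + T′` with `T′` torsion. Proof: on Hu–Shu–Yin's Mordell model `n·Y = a·P + b·[ω]P`
(x1b's `K`-line), `ord₂ q = i + ord₂((a² − ab + b²)/n²)` (`padicValRat_two_of_height_identity`),
so the coordinate has `ord₂ ≥ 2`, and §1 applies because the rational generator is not halvable
(`ne_two_smul_add_torsion_of_incl_generator`). [cite: HuShuYin2019, pp. 8, 12] -/
theorem exists_eq_two_smul_add_torsion_of_model_of_le_padicValRat (hω : ω ^ 2 + ω + 1 = 0)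
    (h2K : Module.finrank ℚ K = 2) {p : ℕ} (hp : p.Prime) (hp2 : p ≠ 2) (B : WeierstrassCurve ℚ)
    [B.IsElliptic] (C : VariableChange ℚ) (hC : C • B = cubeSumCurve (p : ℚ))
    (hrank : (B.baseChange K).mordellWeilRank = 2) (P₀ : B.toAffine.Point)
    (hP : ¬ IsOfFinAddOrder (QuadraticDescent.incl K B P₀))
    (hgen : ∀ Q : B.toAffine.Point, ∃ m : ℤ,
      IsOfFinAddOrder (QuadraticDescent.incl K B Q - m • QuadraticDescent.incl K B P₀))
    (Y : (B.baseChange K).toAffine.Point) {q : ℚ} (hq : q ≠ 0) {i : ℤ}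
    (hid : (q : ℝ) * canonicalHeight (QuadraticDescent.incl K B P₀) = (2 : ℝ) ^ i * canonicalHeight Y)
    (hv : i + 2 ≤ padicValRat 2 q) :
    ∃ Y' T' : (B.baseChange K).toAffine.Point, IsOfFinAddOrder T' ∧ Y = (2 : ℤ) • Y' + T' := by
  -- Hu–Shu–Yin's model over `K` (as in `le_padicValRat_two_of_model`)
  have hCK : (C • B).baseChange K = (cubeSumCurve (p : ℚ)).baseChange K := by rw [hC]
  obtain ⟨ha1, ha2, ha3, ha4⟩ := cubeSumCurve_baseChange_mordell (K := K) (p : ℚ)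
  haveI hBK : (B.baseChange K).IsElliptic := inferInstanceAs (B.map (algebraMap ℚ K)).IsElliptic
  haveI hE : (cubeSumCurve (p : ℚ)).IsElliptic := hC ▸ (inferInstance : (C • B).IsElliptic)
  haveI hEK : ((cubeSumCurve (p : ℚ)).baseChange K).IsElliptic :=
    inferInstanceAs ((cubeSumCurve (p : ℚ)).map (algebraMap ℚ K)).IsElliptic
  let φ : (B.baseChange K).toAffine.Point ≃+ ((cubeSumCurve (p : ℚ)).baseChange K).toAffine.Point :=
    (VariableChange.pointEquivBaseChange B C K).trans (Affine.Point.congrEquiv hCK)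
  have hφ : ∀ X, canonicalHeight (φ X) = canonicalHeight X := fun X => by
    show canonicalHeight (Affine.Point.congrEquiv hCK (VariableChange.pointEquivBaseChange B C K X)) =
      canonicalHeight X
    rw [SylvesterTwoCMNormForm.canonicalHeight_congrEquiv, canonicalHeight_pointEquivBaseChange]
  obtain ⟨θ, hθ⟩ := exists_omegaRot (W := (cubeSumCurve (p : ℚ)).baseChange K) hω ha1 ha2 ha3 ha4
  have hθ0 : (θ : _ → _) 0 = 0 := map_zero θ
  have hP' : ¬IsOfFinAddOrder (φ (QuadraticDescent.incl K B P₀)) := fun h =>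
    hP ((φ.injective.isOfFinAddOrder_iff (f := φ.toAddMonoidHom)).mp h)
  have hr : Module.finrank ℤ ((cubeSumCurve (p : ℚ)).baseChange K).toAffine.Point = 2 := by
    rw [← φ.toIntLinearEquiv.finrank_eq]; exact hrank
  obtain ⟨n, a, b, hn, hY'⟩ :=
    exists_zsmul_eq_of_finrank_eq_two hω ha1 ha2 ha3 ha4 hθ0 hθ hr hP' (φ Y)
  have hid' : (q : ℝ) * canonicalHeight (φ (QuadraticDescent.incl K B P₀)) =
      (2 : ℝ) ^ i * canonicalHeight (φ Y) := by rw [hφ, hφ]; exact hid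
  -- exact valuation ⇒ the coordinate has `ord₂ ≥ 2`
  have hval := padicValRat_two_of_height_identity hω ha1 ha2 ha3 ha4 hθ0 hθ hP'
    IsOfFinAddOrder.zero hn hY' hq hid'
  have hv' : 2 ≤ padicValRat 2 (((a ^ 2 - a * b + b ^ 2 : ℤ) : ℚ) / ((n : ℚ) ^ 2)) := by
    rw [hval] at hv; linarith
  -- the rational generator is not halvable on the Mordell model either
  have hE2 : ∀ Q : (B.baseChange K).toAffine.Point, (2 : ℤ) • Q = 0 → Q = 0 := fun Q h2 =>
    SylvesterTwoFrame.two_torsion_eq_zero_of_model_of_finrank_eq_two K h2K hp hp2 B ⟨C, hC⟩ Q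
      (by rw [two_nsmul]; rwa [two_zsmul] at h2)
  have hnh := ne_two_smul_add_torsion_map φ
    (ne_two_smul_add_torsion_of_incl_generator h2K hE2 P₀ hP hgen)
  obtain ⟨Y'', T'', hT'', hφY⟩ :=
    exists_eq_two_smul_add_torsion_of_two_le_padicValRat hω ha1 ha2 ha3 ha4 hθ0 hθ (omega_ne_one hω)
      hnh n.natAbs le_rfl hn IsOfFinAddOrder.zero hY' hv'
  -- pull back along `φ`
  refine ⟨φ.symm Y'', φ.symm T'', (φ.symm : _ ≃+ _).toAddMonoidHom.isOfFinAddOrder hT'', ?_⟩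
  apply φ.injective
  rw [map_add, map_zsmul, φ.apply_symm_apply, φ.apply_symm_apply]
  exact hφY

/-- **`Y ∈ 2·B(K) + tors ⟺ i + 2 ≤ ord₂ q`** in the engine currency (same setting): the
`2`-divisibility of the displayed point is EXACTLY a `2`-adic inequality on `q`. (`→` is
`add_two_le_padicValRat_two_of_model_of_twoDivisible`, p444380; `←` is the theorem above.)
[cite: HuShuYin2019, pp. 8, 12] -/
theorem twoDivisible_iff_add_two_le_padicValRat_of_model (hω : ω ^ 2 + ω + 1 = 0)
    (h2K : Module.finrank ℚ K = 2) {p : ℕ} (hp : p.Prime) (hp2 : p ≠ 2) (B : WeierstrassCurve ℚ)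
    [B.IsElliptic] (C : VariableChange ℚ) (hC : C • B = cubeSumCurve (p : ℚ))
    (hrank : (B.baseChange K).mordellWeilRank = 2) (P₀ : B.toAffine.Point)
    (hP : ¬ IsOfFinAddOrder (QuadraticDescent.incl K B P₀))
    (hgen : ∀ Q : B.toAffine.Point, ∃ m : ℤ,
      IsOfFinAddOrder (QuadraticDescent.incl K B Q - m • QuadraticDescent.incl K B P₀))
    (Y : (B.baseChange K).toAffine.Point) {q : ℚ} (hq : q ≠ 0) {i : ℤ}
    (hid : (q : ℝ) * canonicalHeight (QuadraticDescent.incl K B P₀) = (2 : ℝ) ^ i * canonicalHeight Y) :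
    (∃ Y' T' : (B.baseChange K).toAffine.Point, IsOfFinAddOrder T' ∧ Y = (2 : ℤ) • Y' + T') ↔
      i + 2 ≤ padicValRat 2 q :=
  ⟨add_two_le_padicValRat_two_of_model_of_twoDivisible hω h2K hp hp2 B C hC hrank P₀ hP hgen Y hq hid,
    exists_eq_two_smul_add_torsion_of_model_of_le_padicValRat hω h2K hp hp2 B C hC hrank P₀ hP hgen Y
      hq hid⟩

end Model

/-! ## §3 Display level: THEOREM C (as typed) from the `2`-integrality of the pair product -/

/-- **Display + `2`-integrality on `p ≡ 7 (mod 9)` ⇒ the typed THEOREM C**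
(`HSYPointTwoDivisibleSevenModNine`): for every prime `p ≡ 7 (9)` with `3 ∉ 𝔽_p^{×3}`, minimal
models `B ≅ E_p`, `A ≅ E_{3p²}`, `K ∋ ω` quadratic, rational generator `P₀` (in `ι`-form) and EVERY
`Y ∈ B(K)` with `(#Ш_an(B)·#Ш_an(A))·ĥ_K(ι P₀) = 2^{−2}·ĥ_K(Y)`: `Y ∈ 2·B(K) + tors`. The display
(PRINT, hypothesis `hH`) is used only to supply `rank_ℤ B(K) = 2` and `#Ш_an(B)·#Ш_an(A) ≠ 0` at the
given `K`; the integrality hypothesis `hI` gives `0 ≤ ord₂ q`, i.e. `i + 2 ≤ ord₂ q` for `i = −2`,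
and §2 concludes. [cite: HuShuYin2019, display (bsd) p. 12] -/
theorem hsyPointTwoDivisibleSevenModNine_of_heightDisplay_of_twoIntegral
    (hH : shaAnPair_mul_height_eq_two_zpow_mul_height) (hI : PairProductTwoIntegralSevenModNine) :
    HSYPointTwoDivisibleSevenModNine := by
  intro p hp h7 h3 A B _ _ _ _ hB hA qB qA hqB hqA K _ _ ω hω h2K P₀ hP hgen Y hid
  obtain ⟨qB', qA', hqB', hqA', hne, hrank, -⟩ := hH p hp (Or.inr h7) h3 A B hB hA K ω hω h2K
  have eB : qB = qB' := by exact_mod_cast hqB.symm.trans hqB'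
  have eA : qA = qA' := by exact_mod_cast hqA.symm.trans hqA'
  have hq : qB * qA ≠ 0 := by rw [eB, eA]; exact hne
  have h0 : 0 ≤ padicValRat 2 (qB * qA) := hI p hp h7 h3 A B hB hA qB qA hqB hqA
  have hp2 : p ≠ 2 := by rintro rfl; norm_num at h7
  obtain ⟨C, hCB⟩ := hB
  exact exists_eq_two_smul_add_torsion_of_model_of_le_padicValRat hω h2K hp hp2 B C hCB hrank P₀ hP
    hgen Y hq hid (by linarith)

/-- **THE TWO TYPED FORMS OF THEOREM C ARE ONE STATEMENT MODULO THE PRINTED DISPLAY**: given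
Hu–Shu–Yin's display, `HSYPointTwoDivisibleSevenModNine ↔ PairProductTwoIntegralSevenModNine`
(`→`: x1b GEN 49's `pairProductTwoIntegral_of_heightDisplay_of_thmC`, p456911; `←`: above). So the
K7t cascade's crux r2 is, honestly read, «`#Ш_an(E_p)·#Ш_an(E_{3p²})` is a `2`-adic integer for
`p ≡ 7 (9)`» — an L-value statement; its only proof on file is MEMO bsd-cm-two §15.5 (C-a)–(C-d)
(Shimura reciprocity for Hu–Shu–Yin's own CM point), cell content, not print, not kernel.
[cite: HuShuYin2019, display (bsd) p. 12] -/
theorem hsyPointTwoDivisibleSevenModNine_iff_pairProductTwoIntegral_of_heightDisplay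
    (hH : shaAnPair_mul_height_eq_two_zpow_mul_height) :
    HSYPointTwoDivisibleSevenModNine ↔ PairProductTwoIntegralSevenModNine :=
  ⟨pairProductTwoIntegral_of_heightDisplay_of_thmC hH,
    hsyPointTwoDivisibleSevenModNine_of_heightDisplay_of_twoIntegral hH⟩

end Summit.BirchSwinnertonDyer.BirchSwinnertonDyer.Theorems.SylvesterTwoNonneg

end
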